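import Literature.AlgebraicTopology.SingularHomology.SphereComplement
import Literature.AlgebraicTopology.SingularHomology.MayerVietorisCriteria
import Literature.AlgebraicTopology.SingularHomology.ExcisionMayerVietorisProofs
import HarnessLib

/-!
# Hatcher's Prop. 2B.1 (vanishing part), unconditionally

`SphereComplement.lean` proves the positive-degree vanishing statements of A. Hatcher, *Algebraic
Topology*, CUP 2002, Prop. 2B.1 — (a) `Hⱼ(X ∖ h(Iᵏ)) = 0` (`j ≠ 0`) for continuous injections
`Iᵏ → X`, (b) `Hᵢ(𝕊ⁿ ∖ h(𝕊ᵏ)) = 0` (`i ≠ 0, n - k - 1`) for embeddings `𝕊ᵏ → 𝕊ⁿ`, `k < n` —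
modulo the Mayer–Vietoris injectivity criterion `Literature.SphereComplement.MVInterInjectivity R M X`
of the ambient space and, for (b), the homology of spheres. Both inputs are now theorems:

* `Literature.SphereComplement.mvInterInjectivity_holds : MVInterInjectivity R M X` for **every** space
  `X` and all coefficients — from the proved concrete Mayer–Vietoris short exact sequence
  `Literature.AlgebraicTopology.SingularHomology.mvSES` of `LocalHomology.lean` (Hatcher §2.2 pp. 149–150, via small chains and
  subdivision), exactly as `Literature.AlgebraicTopology.SingularHomology.mono_csingularHomology_map_subsetInclusion_inter` of
  `MayerVietorisCriteria.lean` but keeping both components of the first Mayer–Vietoris map, and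
  transported from the concrete model `Literature.AlgebraicTopology.SingularHomology.csingularHomology` to Mathlib's singular homology
  `Literature.AlgebraicTopology.SingularHomology.singularHomology` by `csingularHomology.compIso`; hence also
  `Literature.AlgebraicTopology.SingularHomology.SphereComplement.mvInterVanishing_holds`; the same two theorems under the
  canonical discharge names `Literature.AlgebraicTopology.SingularHomology.SphereComplement.MVInterInjectivity_holds`,
  `Literature.AlgebraicTopology.SingularHomology.SphereComplement.MVInterVanishing_holds` (binders as in the definitions);
* the homology of spheres `Literature.AlgebraicTopology.SingularHomology.isZero_singularHomology_sphere_holds`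
  (`ExcisionMayerVietorisProofs.lean`, Hatcher Cor. 2.14).

Consequently (this file):

* `Literature.AlgebraicTopology.SingularHomology.SphereComplement.isZero_compl_range_cube_holds` — Prop. 2B.1(a), degrees `≠ 0`, for every
  Hausdorff `X` with homologically trivial punctures, no further hypothesis;
* `Literature.AlgebraicTopology.SingularHomology.SphereComplement.isZero_compl_range_of_isEmbedding_holds` — Prop. 2B.1(b), vanishing part:
  `Hᵢ(𝕊ⁿ ∖ h(𝕊ᵏ); M) = 0` for every embedding `h : 𝕊ᵏ → 𝕊ⁿ`, `k < n`, `i ≠ 0, n - k - 1`, and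
  every coefficient module, **sorry-free and hypothesis-free**. At `R = M = ℤ` this is the named
  fact `Literature.Topology.FourManifolds.isZero_singularHomology_sphere_compl_sphere` of
  `Literature/Topology/FourManifolds/GluckTwistHomology.lean`, discharged in
  `Literature/Topology/FourManifolds/GluckTwistSphereComplement.lean`.

## References

* A. Hatcher, *Algebraic Topology*, CUP 2002, §2.2 pp. 149–150, Cor. 2.14, Prop. 2B.1
  [HatcherAT2002].

## Design notes

* As in `SingularChainsConcrete`/`LocalHomology`/`MayerVietorisCriteria`,
  `backward.isDefEq.respectTransparency` is turned off (chains of the concrete complex are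
  `Finsupp`s up to unfolding; the first Mayer–Vietoris map is `Subcomplex.mvSubF` up to unfolding).
* No declaration in this file uses `sorry`.
-/

noncomputable section

-- as in `SingularChainsConcrete` / `LocalHomology` / `MayerVietorisCriteria`
set_option backward.isDefEq.respectTransparency false

open CategoryTheory Limits Set Function

universe u v

namespace Literature.AlgebraicTopology.SingularHomology

variable (R : Type v) [CommRing R] (M : Type v) [AddCommGroup M] [Module R M]
variable {X : Type u} [TopologicalSpace X]

/-- Local notation: `𝕊 n` is the unit sphere in `EuclideanSpace ℝ (Fin (n + 1))`. -/
local notation "𝕊 " n:arg => (Metric.sphere (0 : EuclideanSpace ℝ (Fin (n + 1))) 1)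

namespace SphereComplement

/-! ### The injectivity criterion in the concrete model -/

/-- The chain-level factorisation of `C(A ∩ B ↪ B)` through the Mayer–Vietoris subcomplexes:
`C(↥(A ∩ B)) ≅ C(A ∩ B) = C(A) ⊓ C(B) ↪ C(B) ≅ C(↥B)` (the twin of
`Literature.AlgebraicTopology.SingularHomology.csingularChainComplex_map_subsetInclusion_inter` for the second inclusion; Hatcher 2002,
§2.2, p. 150). [folklore] -/
lemma csingularChainComplex_map_subsetInclusion_inter_right (A B : Set X) :
    csingularChainComplex.map R M (subsetInclusion (inter_subset_right : A ∩ B ⊆ B)) =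
      subspaceLift R M X (A ∩ B) ≫ Subcomplex.incl (chainsInSub_inter R M A B).le ≫
        Subcomplex.incl (inf_le_right : chainsInSub R M X A ⊓ chainsInSub R M X B ≤ _) ≫
          inv (subspaceLift R M X B) := by
  rw [Subcomplex.incl_comp_incl_assoc, clocalHomology.subspaceLift_comp_incl_assoc,
    IsIso.hom_inv_id, Category.comp_id]

/-- `H(A ∩ B ↪ B)` factors as (iso) ≫ `H(incl : C(A) ⊓ C(B) → C(B))` ≫ (iso). [folklore] -/
lemma csingularHomology_map_subsetInclusion_inter_right (A B : Set X) (j : ℕ) :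
    csingularHomology.map R M (subsetInclusion (inter_subset_right : A ∩ B ⊆ B)) j =
      (HomologicalComplex.homologyMap (subspaceLift R M X (A ∩ B)) j ≫
        HomologicalComplex.homologyMap (Subcomplex.incl (chainsInSub_inter R M A B).le) j) ≫
        HomologicalComplex.homologyMap
          (Subcomplex.incl (inf_le_right : chainsInSub R M X A ⊓ chainsInSub R M X B ≤ _)) j ≫
          HomologicalComplex.homologyMap (inv (subspaceLift R M X B)) j := by
  rw [csingularHomology.map, csingularChainComplex_map_subsetInclusion_inter_right,
    HomologicalComplex.homologyMap_comp, HomologicalComplex.homologyMap_comp,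
    HomologicalComplex.homologyMap_comp, Category.assoc]

/-- **Mayer–Vietoris, injectivity criterion with both components** (concrete form, proved). Let
`A`, `B ⊆ X` be open with `Hⱼ₊₁(A ∪ B; M) = 0`. A class of `Hⱼ(A ∩ B; M)` which dies in `Hⱼ(A; M)`
and in `Hⱼ(B; M)` is zero: the connecting map `Hⱼ₊₁(A ∪ B) → Hⱼ(A ∩ B)` vanishes, so
`x ↦ (i_{A*} x, i_{B*} x)` is injective by exactness of the Mayer–Vietoris sequence at `Hⱼ(A ∩ B)`
(Hatcher, *Algebraic Topology*, §2.2, p. 149; the sequence is `Literature.AlgebraicTopology.SingularHomology.mvSES_shortExact` of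
`LocalHomology.lean`). [cite: HatcherAT2002, §2.2 p. 149] -/
theorem eq_zero_of_csingularHomology_map_eq_zero {A B : Set X} (hA : IsOpen A) (hB : IsOpen B)
    (j : ℕ) (hU : IsZero (csingularHomology R M ↥(A ∪ B) (j + 1)))
    (x : csingularHomology R M ↥(A ∩ B) j)
    (h₁ : csingularHomology.map R M (subsetInclusion (inter_subset_left : A ∩ B ⊆ A)) j x = 0)
    (h₂ : csingularHomology.map R M (subsetInclusion (inter_subset_right : A ∩ B ⊆ B)) j x = 0) :
    x = 0 := by
  have h3 : IsZero ((mvSES R M X A B).X₃.homology (j + 1)) :=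
    hU.of_iso (mvUnionHomologyIso R M hA hB (j + 1))
  have hδ0 : (mvSES_shortExact R M A B).δ (j + 1) j rfl = 0 := h3.eq_of_src _ _
  have hf : Mono (HomologicalComplex.homologyMap (mvSES R M X A B).f j) :=
    ((mvSES_shortExact R M A B).homology_exact₁ (j + 1) j rfl).mono_g hδ0
  -- the image `y` of `x` in `Hⱼ(C(A) ⊓ C(B))`
  let e : csingularHomology R M ↥(A ∩ B) j ⟶ (mvSES R M X A B).X₁.homology j :=
    HomologicalComplex.homologyMap (subspaceLift R M X (A ∩ B)) j ≫
      HomologicalComplex.homologyMap (Subcomplex.incl (chainsInSub_inter R M A B).le) j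
  haveI : IsIso e := IsIso.comp_isIso
  have hinjA : Injective (HomologicalComplex.homologyMap (inv (subspaceLift R M X A)) j) :=
    (ModuleCat.mono_iff_injective _).mp inferInstance
  have hinjB : Injective (HomologicalComplex.homologyMap (inv (subspaceLift R M X B)) j) :=
    (ModuleCat.mono_iff_injective _).mp inferInstance
  have hy₁ : HomologicalComplex.homologyMap
      (Subcomplex.incl (inf_le_left : chainsInSub R M X A ⊓ chainsInSub R M X B ≤ _)) j (e x)
        = 0 := by
    rw [csingularHomology_map_subsetInclusion_inter, ModuleCat.comp_apply, ModuleCat.comp_apply]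
      at h₁
    exact hinjA (h₁.trans (map_zero _).symm)
  have hy₂ : HomologicalComplex.homologyMap
      (Subcomplex.incl (inf_le_right : chainsInSub R M X A ⊓ chainsInSub R M X B ≤ _)) j (e x)
        = 0 := by
    rw [csingularHomology_map_subsetInclusion_inter_right, ModuleCat.comp_apply,
      ModuleCat.comp_apply] at h₂
    exact hinjB (h₂.trans (map_zero _).symm)
  have hy : HomologicalComplex.homologyMap (mvSES R M X A B).f j (e x) = 0 := by
    change HomologicalComplex.homologyMap (Subcomplex.mvSubF _ _) j (e x) = 0
    rw [homologyMap_lift_eq_zero_iff]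
    exact ⟨hy₁, hy₂⟩
  have hex : e x = 0 := (ModuleCat.mono_iff_injective _).mp hf (by rw [hy, map_zero])
  have hx : x = (inv e) (e x) := by
    rw [← ModuleCat.comp_apply, IsIso.hom_inv_id, ModuleCat.id_apply]
  rw [hx, hex, map_zero]

/-! ### The two criteria hold, for every space -/

/-- **The Mayer–Vietoris injectivity criterion holds** for Mathlib's singular homology of every
space `X` and all coefficients (Hatcher, *Algebraic Topology*, §2.2, p. 149), from the proved
concrete Mayer–Vietoris sequence (`eq_zero_of_csingularHomology_map_eq_zero`) transported along
`csingularHomology.compIso`. [cite: HatcherAT2002, §2.2 p. 149] -/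
theorem mvInterInjectivity_holds : MVInterInjectivity R M X := by
  intro U₁ U₂ hU₁ hU₂ i h α h₁ h₂
  have h' : IsZero (csingularHomology R M ↥(U₁ ∪ U₂) (i + 1)) :=
    h.of_iso (csingularHomology.compIso R M _ _)
  have key := eq_zero_of_csingularHomology_map_eq_zero R M hU₁ hU₂ i h'
    ((csingularHomology.compIso R M ↥(U₁ ∩ U₂) i).inv α)
    (by rw [csingularHomology.map_eq_conj, ModuleCat.comp_apply, ModuleCat.comp_apply,
      Iso.inv_hom_id_apply, h₁, map_zero])
    (by rw [csingularHomology.map_eq_conj, ModuleCat.comp_apply, ModuleCat.comp_apply,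
      Iso.inv_hom_id_apply, h₂, map_zero])
  rw [← (csingularHomology.compIso R M ↥(U₁ ∩ U₂) i).inv_hom_id_apply α, key, map_zero]

/-- **The Mayer–Vietoris vanishing criterion for intersections holds** for Mathlib's singular
homology of every space (Hatcher, *Algebraic Topology*, §2.2, p. 149).
[cite: HatcherAT2002, §2.2 p. 149] -/
theorem mvInterVanishing_holds : MVInterVanishing R M X :=
  (mvInterInjectivity_holds R M).mvInterVanishing

/-! ### Hatcher's Prop. 2B.1, vanishing part, unconditionally -/

/-- **Hatcher's Prop. 2B.1(a), positive degrees, unconditionally**: for a Hausdorff space `X` whose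
punctured open subsets `X ∖ {x}` have no homology in positive degrees and every continuous
injection `h : Iᵏ → X`, `Hⱼ(X ∖ h(Iᵏ); M) = 0` for `j ≠ 0` (Hatcher, *Algebraic Topology*,
Prop. 2B.1(a), stated there for `X = Sⁿ`). [cite: HatcherAT2002, Prop. 2B.1(a)] -/
theorem isZero_compl_range_cube_holds [T2Space X]
    (hpt : ∀ (x : X) (j : ℕ), j ≠ 0 → IsZero (singularHomology R M ↥({x}ᶜ : Set X) j)) (k : ℕ)
    (h : C((Fin k → unitInterval), X)) (hinj : Injective h) (j : ℕ) (hj : j ≠ 0) :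
    IsZero (singularHomology R M ↥(range h)ᶜ j) :=
  isZero_compl_range_cube (mvInterInjectivity_holds R M (X := X)) hpt k h hinj j hj

/-- **Hatcher's Prop. 2B.1(b), vanishing part, unconditionally: `Hᵢ(𝕊ⁿ ∖ h(𝕊ᵏ); M) = 0` for an
embedding `h : 𝕊ᵏ → 𝕊ⁿ`, `k < n`, and `i ≠ 0, n - k - 1`**, for every commutative ring `R` and
`R`-module `M` (Hatcher, *Algebraic Topology*, Prop. 2B.1(b)). At `R = M = ℤ` this is the named
fact `Literature.Topology.FourManifolds.isZero_singularHomology_sphere_compl_sphere` (`GluckTwistHomology.lean`).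
[cite: HatcherAT2002, Prop. 2B.1(b)] -/
theorem isZero_compl_range_of_isEmbedding_holds {k n i : ℕ} (h : 𝕊 k → 𝕊 n)
    (he : Topology.IsEmbedding h) (hkn : k < n) (hi0 : i ≠ 0) (hin : i ≠ n - k - 1) :
    IsZero (singularHomology R M ↥((range h)ᶜ : Set (𝕊 n)) i) :=
  isZero_compl_range_of_isEmbedding_of_criteria (isZero_singularHomology_sphere_holds R M)
    (mvInterInjectivity_holds R M) h he hkn hi0 hin

/-! ### Canonical discharges of the two named criteria -/

variable (X) in
/-- **Discharge of the named fact `MVInterInjectivity`**: the Mayer–Vietoris injectivity criterion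
holds for Mathlib's singular homology of every topological space `X`, every commutative ring `R`
and every `R`-module `M` — for open `U₁`, `U₂ ⊆ X` with `Hᵢ₊₁(U₁ ∪ U₂; M) = 0` the map
`Φ : Hᵢ(U₁ ∩ U₂) → Hᵢ(U₁) ⊕ Hᵢ(U₂)` of the Mayer–Vietoris sequence
`Hᵢ₊₁(U₁ ∪ U₂) →∂ Hᵢ(U₁ ∩ U₂) →Φ Hᵢ(U₁) ⊕ Hᵢ(U₂)` (Hatcher, *Algebraic Topology*, §2.2, p. 149,
for the open cover `{U₁, U₂}` of `U₁ ∪ U₂`) is injective. This is `mvInterInjectivity_holds`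
under the canonical `_holds` name, with the binders of the definition.
[cite: HatcherAT2002, §2.2 p. 149] -/
theorem MVInterInjectivity_holds : MVInterInjectivity R M X :=
  mvInterInjectivity_holds R M

variable (X) in
/-- **Discharge of the named fact `MVInterVanishing`**: the Mayer–Vietoris vanishing criterion for
intersections holds for Mathlib's singular homology of every topological space `X`, every
commutative ring `R` and every `R`-module `M` — for open `U₁`, `U₂ ⊆ X`, if `Hᵢ(U₁; M) = 0`,
`Hᵢ(U₂; M) = 0` and `Hᵢ₊₁(U₁ ∪ U₂; M) = 0` then `Hᵢ(U₁ ∩ U₂; M) = 0`, both neighbours of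
`Hᵢ(U₁ ∩ U₂)` in the exact Mayer–Vietoris sequence
`Hᵢ₊₁(U₁ ∪ U₂) →∂ Hᵢ(U₁ ∩ U₂) →Φ Hᵢ(U₁) ⊕ Hᵢ(U₂)` of the open cover `{U₁, U₂}` of `U₁ ∪ U₂`
being zero (Hatcher, *Algebraic Topology*, §2.2, p. 149; the sequence itself is the long exact
sequence of the proved short exact sequence of chain complexes
`0 → C(U₁ ∩ U₂) → C(U₁) ⊕ C(U₂) → C(U₁ + U₂) → 0`, `Literature.AlgebraicTopology.SingularHomology.mvSES`,
combined with `H(C(U₁ + U₂)) ≅ H(U₁ ∪ U₂)`, Hatcher Prop. 2.21, p. 150). This is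
`mvInterVanishing_holds` under the canonical `_holds` name, with the binders of the definition.
[cite: HatcherAT2002, §2.2 p. 149] -/
theorem MVInterVanishing_holds : MVInterVanishing R M X :=
  (MVInterInjectivity_holds R M X).mvInterVanishing

end SphereComplement

end Literature.AlgebraicTopology.SingularHomology
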